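import Summits.QuantumFields.YangMills.Theorems.SqueezedSkewnessShellSignChannelSelection
import Literature.Analysis.FluidPDE.OctahedralSymmetry
import HarnessLib

/-!
# Route `SqueezedSkewness`, crux `ShellSign` (stmt-QuantumFields-27861): the hyperoctahedral channel selection in the CRUX'S OWN
# VOCABULARY — multilinear forms on `ℝ⁴` invariant under the signed-permutation ISOMETRIES

Sequel of `Theorems/SqueezedSkewnessShellSignChannelSelection.lean` (index form).  `ShellSign` quantifies the symmetry of the shell `h` over
the linear isometries `T` of `EuclideanSpace ℝ (Fin 4)` with `T eᵢ = ±eⱼ` — exactly the tree's hyperoctahedral group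
`Literature.Analysis.FluidPDE.IsSignedPermIsometry` (`isSignedPermIsometry_iff_shellSymmetry` below records the equivalence of the two
spellings).  This file transports the index-form channel selection to that vocabulary:

* `fourLinear_apply_eq_sum` — a 4-linear form on `ℝ⁴` is determined by its values on coordinate vectors (expansion in
  `EuclideanSpace.basisFun`);
* ★`fourLinear_eq_of_isSignedPermIsometry` — a 4-linear form `R`, antisymmetric in its first and in its second pair of arguments and
  invariant under every signed-permutation isometry, is `R(e₀,e₁,e₀,e₁)·(⟨u,w⟩⟨v,z⟩ − ⟨u,z⟩⟨v,w⟩)` (inner products written as coordinate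
  sums): the `B₄`-invariant curvature-type forms on `ℝ⁴` are the multiples of the `Λ²`-identity — the scalar `[tr F²]` channel; the Weyl,
  traceless-symmetric and pseudoscalar channels carry no invariant (index form: `ShellSignChannelSelection.rank_four_eq_of_hyperoctahedral`).

Fleet lead `ym-spine-19353-p1` g21 (`--supports stmt-QuantumFields-27861`; layer-2 lemma invited by the route thesis «Inside ShellSign: the B₄
channel selection (representation theory, provable now)»).  HONEST FRAMING: finite-dimensional linear algebra; the lattice OPE with uniform
remainder, the sign and the Wilson coefficient of `ShellSign` are NOT touched; no crux, NT statement, rung of record or mass gap is proved.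
[folklore]
-/

set_option autoImplicit false

namespace Summit.QuantumFields.YangMills.Theorems.ShellSignChannelSelection

open Literature.Analysis.FluidPDE (IsSignedPermIsometry signedPermIsometry signedPermIsometry_single
  isSignedPermIsometry_signedPermIsometry)

/-! ## §1 The two spellings of the hyperoctahedral group agree -/

/-- `ShellSign`'s symmetry clause on an isometry `T` (`∀ i, ∃ j ε, (ε = 1 ∨ ε = −1) ∧ T eᵢ = ε • eⱼ`) is the tree's
`IsSignedPermIsometry T`. [folklore] -/
theorem isSignedPermIsometry_iff_shellSymmetry (T : EuclideanSpace ℝ (Fin 4) ≃ₗᵢ[ℝ] EuclideanSpace ℝ (Fin 4)) :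
    IsSignedPermIsometry T ↔ ∀ i : Fin 4, ∃ j : Fin 4, ∃ ε : ℝ, (ε = 1 ∨ ε = -1) ∧
      T (EuclideanSpace.single i (1 : ℝ)) = ε • EuclideanSpace.single j (1 : ℝ) := by
  constructor
  · intro h i
    obtain ⟨j, hj | hj⟩ := h i
    · exact ⟨j, 1, Or.inl rfl, by rw [hj, one_smul]⟩
    · exact ⟨j, -1, Or.inr rfl, by rw [hj, neg_one_smul]⟩
  · intro h i
    obtain ⟨j, ε, hε | hε, hT⟩ := h i
    · exact ⟨j, Or.inl (by rw [hT, hε, one_smul])⟩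
    · exact ⟨j, Or.inr (by rw [hT, hε, neg_one_smul])⟩

/-! ## §2 Four-linear forms on `ℝ⁴`: expansion in coordinate vectors -/

/-- Scalars pull out of all four arguments of a 4-linear form. [folklore] -/
theorem fourLinear_smul (R : EuclideanSpace ℝ (Fin 4) →ₗ[ℝ] EuclideanSpace ℝ (Fin 4) →ₗ[ℝ] EuclideanSpace ℝ (Fin 4) →ₗ[ℝ]
      EuclideanSpace ℝ (Fin 4) →ₗ[ℝ] ℝ) (a b c d : ℝ) (u v w z : EuclideanSpace ℝ (Fin 4)) :
    R (a • u) (b • v) (c • w) (d • z) = a * b * c * d * R u v w z := by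
  simp only [map_smul, LinearMap.smul_apply, smul_eq_mul]
  ring

/-- **Expansion in coordinate vectors**: `R u v w z = Σ_{μνρσ} u_μ v_ν w_ρ z_σ · R(e_μ, e_ν, e_ρ, e_σ)`. [folklore] -/
theorem fourLinear_apply_eq_sum (R : EuclideanSpace ℝ (Fin 4) →ₗ[ℝ] EuclideanSpace ℝ (Fin 4) →ₗ[ℝ] EuclideanSpace ℝ (Fin 4) →ₗ[ℝ]
      EuclideanSpace ℝ (Fin 4) →ₗ[ℝ] ℝ) (u v w z : EuclideanSpace ℝ (Fin 4)) :
    R u v w z = ∑ μ, ∑ ν, ∑ ρ, ∑ σ, u μ * v ν * w ρ * z σ *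
      R (EuclideanSpace.single μ (1 : ℝ)) (EuclideanSpace.single ν (1 : ℝ)) (EuclideanSpace.single ρ (1 : ℝ))
        (EuclideanSpace.single σ (1 : ℝ)) := by
  have hexp : ∀ x : EuclideanSpace ℝ (Fin 4), x = ∑ i, x i • EuclideanSpace.single i (1 : ℝ) := by
    intro x
    conv_lhs => rw [← (EuclideanSpace.basisFun (Fin 4) ℝ).sum_repr x]
    refine Finset.sum_congr rfl fun i _ => ?_
    rw [EuclideanSpace.basisFun_repr, EuclideanSpace.basisFun_apply]
  -- one argument at a time
  have L1 : ∀ x b c d : EuclideanSpace ℝ (Fin 4), R x b c d = ∑ μ, x μ * R (EuclideanSpace.single μ (1 : ℝ)) b c d := by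
    intro x b c d
    conv_lhs => rw [hexp x]
    simp only [map_sum, map_smul, LinearMap.sum_apply, LinearMap.smul_apply, smul_eq_mul]
  have L2 : ∀ a x c d : EuclideanSpace ℝ (Fin 4), R a x c d = ∑ ν, x ν * R a (EuclideanSpace.single ν (1 : ℝ)) c d := by
    intro a x c d
    conv_lhs => rw [hexp x]
    simp only [map_sum, map_smul, LinearMap.sum_apply, LinearMap.smul_apply, smul_eq_mul]
  have L3 : ∀ a b x d : EuclideanSpace ℝ (Fin 4), R a b x d = ∑ ρ, x ρ * R a b (EuclideanSpace.single ρ (1 : ℝ)) d := by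
    intro a b x d
    conv_lhs => rw [hexp x]
    simp only [map_sum, map_smul, LinearMap.sum_apply, LinearMap.smul_apply, smul_eq_mul]
  have L4 : ∀ a b c x : EuclideanSpace ℝ (Fin 4), R a b c x = ∑ σ, x σ * R a b c (EuclideanSpace.single σ (1 : ℝ)) := by
    intro a b c x
    conv_lhs => rw [hexp x]
    simp only [map_sum, map_smul, smul_eq_mul]
  rw [L1]
  refine Finset.sum_congr rfl fun μ _ => ?_
  rw [L2, Finset.mul_sum]
  refine Finset.sum_congr rfl fun ν _ => ?_
  rw [L3, Finset.mul_sum, Finset.mul_sum]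
  refine Finset.sum_congr rfl fun ρ _ => ?_
  rw [L4, Finset.mul_sum, Finset.mul_sum, Finset.mul_sum]
  refine Finset.sum_congr rfl fun σ _ => ?_
  ring

/-! ## §3 The channel selection for invariant four-linear forms -/

/-- Kronecker sums: `Σ_σ f σ · [κ = σ] = f κ`. [folklore] -/
theorem sum_mul_ite_eq (f : Fin 4 → ℝ) (κ : Fin 4) : ∑ σ, f σ * (if κ = σ then (1 : ℝ) else 0) = f κ := by
  simp [mul_ite, mul_one, mul_zero, Finset.sum_ite_eq]

/-- ★ **Hyperoctahedrally invariant curvature-type four-linear forms on `ℝ⁴` are multiples of the `Λ²`-identity.**  If `R` is 4-linear,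
antisymmetric in `(u, v)` and in `(w, z)`, and `R(gu, gv, gw, gz) = R(u, v, w, z)` for every signed-permutation isometry `g` (the symmetry
group of `ShellSign`'s shells), then
`R(u, v, w, z) = R(e₀, e₁, e₀, e₁) · (Σᵢuᵢwᵢ · Σᵢvᵢzᵢ − Σᵢuᵢzᵢ · Σᵢvᵢwᵢ)` — only the scalar channel survives. [folklore] -/
theorem fourLinear_eq_of_isSignedPermIsometry (R : EuclideanSpace ℝ (Fin 4) →ₗ[ℝ] EuclideanSpace ℝ (Fin 4) →ₗ[ℝ]
      EuclideanSpace ℝ (Fin 4) →ₗ[ℝ] EuclideanSpace ℝ (Fin 4) →ₗ[ℝ] ℝ)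
    (hanti₁ : ∀ u v w z, R v u w z = -R u v w z) (hanti₂ : ∀ u v w z, R u v z w = -R u v w z)
    (hinv : ∀ g : EuclideanSpace ℝ (Fin 4) ≃ₗᵢ[ℝ] EuclideanSpace ℝ (Fin 4), IsSignedPermIsometry g →
      ∀ u v w z, R (g u) (g v) (g w) (g z) = R u v w z)
    (u v w z : EuclideanSpace ℝ (Fin 4)) :
    R u v w z = R (EuclideanSpace.single 0 (1 : ℝ)) (EuclideanSpace.single 1 (1 : ℝ)) (EuclideanSpace.single 0 (1 : ℝ))
        (EuclideanSpace.single 1 (1 : ℝ)) *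
      ((∑ i, u i * w i) * (∑ i, v i * z i) - (∑ i, u i * z i) * (∑ i, v i * w i)) := by
  -- the index tensor of `R`
  set e : Fin 4 → EuclideanSpace ℝ (Fin 4) := fun i => EuclideanSpace.single i (1 : ℝ) with he
  set K : Fin 4 → Fin 4 → Fin 4 → Fin 4 → ℝ := fun μ ν ρ σ => R (e μ) (e ν) (e ρ) (e σ) with hK
  have hKa₁ : ∀ μ ν ρ σ, K ν μ ρ σ = -K μ ν ρ σ := fun μ ν ρ σ => hanti₁ _ _ _ _
  have hKa₂ : ∀ μ ν ρ σ, K μ ν σ ρ = -K μ ν ρ σ := fun μ ν ρ σ => hanti₂ _ _ _ _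
  -- sign flips act diagonally on the coordinate vectors
  have hKsign : ∀ s : Fin 4 → ℝ, (∀ i, s i = 1 ∨ s i = -1) →
      ∀ μ ν ρ σ, s μ * s ν * s ρ * s σ * K μ ν ρ σ = K μ ν ρ σ := by
    intro s hs μ ν ρ σ
    let t : Fin 4 → ℤˣ := fun i => if s i = 1 then 1 else -1
    have ht : ∀ i, ((t i : ℤ) : ℝ) = s i := by
      intro i
      rcases hs i with h | h
      · show (((if s i = 1 then (1 : ℤˣ) else -1 : ℤˣ) : ℤ) : ℝ) = s i
        rw [if_pos h, Units.val_one, h]; norm_num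
      · have h1 : ¬ s i = 1 := by rw [h]; norm_num
        show (((if s i = 1 then (1 : ℤˣ) else -1 : ℤˣ) : ℤ) : ℝ) = s i
        rw [if_neg h1, Units.val_neg, Units.val_one, h]; norm_num
    have hg : ∀ i, signedPermIsometry (Equiv.refl (Fin 4)) t (e i) = s i • e i := by
      intro i
      rw [he]
      dsimp only
      rw [signedPermIsometry_single, Equiv.refl_symm, Equiv.refl_apply, ht]
    have h := hinv _ (isSignedPermIsometry_signedPermIsometry (Equiv.refl (Fin 4)) t) (e μ) (e ν) (e ρ) (e σ)
    rw [hg, hg, hg, hg, fourLinear_smul] at h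
    exact h
  -- coordinate permutations permute the coordinate vectors
  have hKperm : ∀ π : Equiv.Perm (Fin 4), ∀ μ ν ρ σ, K (π μ) (π ν) (π ρ) (π σ) = K μ ν ρ σ := by
    intro π μ ν ρ σ
    have hg : ∀ i, signedPermIsometry π.symm (fun _ => (1 : ℤˣ)) (e i) = e (π i) := by
      intro i
      rw [he]
      dsimp only
      rw [signedPermIsometry_single, Equiv.symm_symm, Units.val_one, Int.cast_one, one_smul]
    have h := hinv _ (isSignedPermIsometry_signedPermIsometry π.symm fun _ => (1 : ℤˣ)) (e μ) (e ν) (e ρ) (e σ)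
    rw [hg, hg, hg, hg] at h
    exact h
  -- the index-form channel selection
  have hKeq := rank_four_eq_of_hyperoctahedral K hKa₁ hKa₂ hKsign hKperm
  set c : ℝ := K 0 1 0 1 with hc
  -- expand and contract
  rw [fourLinear_apply_eq_sum]
  have step : ∀ μ ν ρ σ, u μ * v ν * w ρ * z σ * R (EuclideanSpace.single μ (1 : ℝ)) (EuclideanSpace.single ν (1 : ℝ))
      (EuclideanSpace.single ρ (1 : ℝ)) (EuclideanSpace.single σ (1 : ℝ)) =
      c * (u μ * w ρ * (if μ = ρ then (1 : ℝ) else 0) * (v ν * z σ * (if ν = σ then (1 : ℝ) else 0))) -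
        c * (u μ * z σ * (if μ = σ then (1 : ℝ) else 0) * (v ν * w ρ * (if ν = ρ then (1 : ℝ) else 0))) := by
    intro μ ν ρ σ
    have : R (EuclideanSpace.single μ (1 : ℝ)) (EuclideanSpace.single ν (1 : ℝ)) (EuclideanSpace.single ρ (1 : ℝ))
        (EuclideanSpace.single σ (1 : ℝ)) = K μ ν ρ σ := rfl
    rw [this, hKeq μ ν ρ σ]
    ring
  have hcR : R (EuclideanSpace.single 0 (1 : ℝ)) (EuclideanSpace.single 1 (1 : ℝ)) (EuclideanSpace.single 0 (1 : ℝ))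
      (EuclideanSpace.single 1 (1 : ℝ)) = c := rfl
  rw [hcR]
  -- the two Kronecker contractions
  have A : ∑ μ, ∑ ν, ∑ ρ, ∑ σ, u μ * w ρ * (if μ = ρ then (1 : ℝ) else 0) * (v ν * z σ * (if ν = σ then (1 : ℝ) else 0)) =
      (∑ i, u i * w i) * (∑ i, v i * z i) := by
    have inner : ∀ μ ν, ∑ ρ, ∑ σ, u μ * w ρ * (if μ = ρ then (1 : ℝ) else 0) * (v ν * z σ * (if ν = σ then (1 : ℝ) else 0)) =
        (u μ * w μ) * (v ν * z ν) := by
      intro μ ν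
      have e1 : ∀ ρ, ∑ σ, u μ * w ρ * (if μ = ρ then (1 : ℝ) else 0) * (v ν * z σ * (if ν = σ then (1 : ℝ) else 0)) =
          u μ * w ρ * (if μ = ρ then (1 : ℝ) else 0) * (v ν * z ν) := fun ρ => by
        rw [← Finset.mul_sum, sum_mul_ite_eq (fun σ => v ν * z σ) ν]
      simp_rw [e1]
      rw [← Finset.sum_mul, sum_mul_ite_eq (fun ρ => u μ * w ρ) μ]
    simp_rw [inner]
    rw [Finset.sum_mul]
    refine Finset.sum_congr rfl fun μ _ => ?_
    rw [Finset.mul_sum]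
  have B : ∑ μ, ∑ ν, ∑ ρ, ∑ σ, u μ * z σ * (if μ = σ then (1 : ℝ) else 0) * (v ν * w ρ * (if ν = ρ then (1 : ℝ) else 0)) =
      (∑ i, u i * z i) * (∑ i, v i * w i) := by
    have inner : ∀ μ ν, ∑ ρ, ∑ σ, u μ * z σ * (if μ = σ then (1 : ℝ) else 0) * (v ν * w ρ * (if ν = ρ then (1 : ℝ) else 0)) =
        (u μ * z μ) * (v ν * w ν) := by
      intro μ ν
      have e1 : ∀ ρ, ∑ σ, u μ * z σ * (if μ = σ then (1 : ℝ) else 0) * (v ν * w ρ * (if ν = ρ then (1 : ℝ) else 0)) =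
          (u μ * z μ) * (v ν * w ρ * (if ν = ρ then (1 : ℝ) else 0)) := fun ρ => by
        rw [← Finset.sum_mul, sum_mul_ite_eq (fun σ => u μ * z σ) μ]
      simp_rw [e1]
      rw [← Finset.mul_sum, sum_mul_ite_eq (fun ρ => v ν * w ρ) ν]
    simp_rw [inner]
    rw [Finset.sum_mul]
    refine Finset.sum_congr rfl fun μ _ => ?_
    rw [Finset.mul_sum]
  have split : ∑ μ, ∑ ν, ∑ ρ, ∑ σ,
      (c * (u μ * w ρ * (if μ = ρ then (1 : ℝ) else 0) * (v ν * z σ * (if ν = σ then (1 : ℝ) else 0))) -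
        c * (u μ * z σ * (if μ = σ then (1 : ℝ) else 0) * (v ν * w ρ * (if ν = ρ then (1 : ℝ) else 0)))) =
      c * ((∑ i, u i * w i) * (∑ i, v i * z i)) - c * ((∑ i, u i * z i) * (∑ i, v i * w i)) := by
    rw [← A, ← B]
    simp only [Finset.sum_sub_distrib, Finset.mul_sum]
  rw [Finset.sum_congr rfl fun μ _ => Finset.sum_congr rfl fun ν _ => Finset.sum_congr rfl fun ρ _ =>
    Finset.sum_congr rfl fun σ _ => step μ ν ρ σ, split]
  ring

end Summit.QuantumFields.YangMills.Theorems.ShellSignChannelSelection
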